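import Mathlib
import HarnessLib
import Literature.NumberTheory.LFunctions.ZetaScrew
import Literature.NumberTheory.LFunctions.UniformWeilPositivityRH
import Literature.NumberTheory.LFunctions.YoshidaPositivityThreshold
import Summits.RiemannHypothesis.RiemannHypothesis.Theorems.WeilFormatCDataA1RungCB
import Summits.RiemannHypothesis.RiemannHypothesis.Theorems.IntegerScrewWeilWindowRatio

/-!
# Route `IntegerScrew` — the SHAPE of the ratio family: Yoshida's threshold in screw coordinates
# (the good ratios of the integer screw matrices form an initial segment `{1, …, R₀}` with `R₀ ≥ 7`, or all of `ℕ`)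

Sequel to `IntegerScrewWeilWindowRatio` (PIVOT-LAW §16.7): each ratio `R` of Suzuki's integer screw
matrices `S_M = [G(log m, log m')]` is exactly the Weil rung `(log R)/2` —
`WeilPositivityOn ((log R)/2) ↔ ∀ N M, M ≤ R(N+1) → (S_M ⪰ 0 on the balanced vectors on (N, M])`.
Call such an `R` a GOOD RATIO (spelled out below, no definition is introduced).  Yoshida 1992 Prop. 6
(tree: `Yoshida1992_prop6`, `riemannHypothesis_or_exists_threshold`: under `¬RH` the Weil-positive
depths form a closed initial segment `(0, a₀]`) and the certified rung `a = 1`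
(`WeilFormatCData.A1.weilPositivityOn_one`) give the complete RH-free shape of the ratio family:

* `screwWindow_goodRatio_anti` — good ratios are downward closed; `7` is a good ratio by gen21's
  `screwWindow_nonneg_of_le_seven_mul` (`IntegerScrewWeilWindowPSD`, the rung `a = 1`);
* `screwWindow_ratio_threshold` — **UNCONDITIONAL DICHOTOMY**: either every ratio is good, or there is
  `R₀ ≥ 7` such that exactly the ratios `R ≤ R₀` are good and every ratio `R > R₀` FAILS ON EVERY
  SUFFICIENTLY HIGH WINDOW (`∃ N₁, ∀ N ≥ N₁, ∃ M ≤ R(N+1)`, a balanced vector on `(N, M]` with negative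
  form — the eventual dichotomy of `IntegerScrewWeilWindowRatio` §8);
* `not_riemannHypothesis_iff_exists_ratio_threshold` — the second alternative is `¬RH`
  (RH-EQUIVALENT content, labelled; Weil's criterion).

LABEL: RH-FREE for the dichotomy and the two structural facts; nothing here bears on the truth of RH
(which alternative holds is RH itself).

References: H. Yoshida, Adv. Stud. Pure Math. 21 (1992) Prop. 6; M. Suzuki, J. Lond. Math. Soc. (2)
108 (2023) = arXiv:2206.03682, (1.4)–(1.5), Thm 1.2, Prop. 3.1 [Suzuki2023]; E. Bombieri, Rend.
Lincei (9) 11 (2000) Thm. 2.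
-/

noncomputable section

-- D-0017: `Summit.<S>.<S>.…` is the designed namespace of a single-problem summit.
set_option linter.dupNamespace false

namespace Summit.RiemannHypothesis.RiemannHypothesis.Theorems.IntegerScrew

open Literature.NumberTheory.LFunctions Finset Filter Topology

/-- Good ratios are DOWNWARD CLOSED (RH-FREE): if every window of ratio `≤ R` is non-negative on
balanced vectors, so is every window of ratio `≤ R'` for `R' ≤ R` (a window with `M ≤ R'(N+1)` has
`M ≤ R(N+1)`). [folklore] -/
theorem screwWindow_goodRatio_anti {R R' : ℕ} (hRR : R' ≤ R)
    (h : ∀ N M : ℕ, M ≤ R * (N + 1) → ∀ x : ℕ → ℝ, ∑ m ∈ Ioc N M, x m = 0 →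
      0 ≤ ∑ m ∈ Ioc N M, ∑ m' ∈ Ioc N M,
        zetaScrewKernel (Real.log m) (Real.log m') * (x m * x m'))
    (N M : ℕ) (hNM : M ≤ R' * (N + 1)) (x : ℕ → ℝ) (hx : ∑ m ∈ Ioc N M, x m = 0) :
    0 ≤ ∑ m ∈ Ioc N M, ∑ m' ∈ Ioc N M,
      zetaScrewKernel (Real.log m) (Real.log m') * (x m * x m') :=
  h N M (hNM.trans (Nat.mul_le_mul_right _ hRR)) x hx

/-- **THE SHAPE OF THE RATIO FAMILY — UNCONDITIONAL DICHOTOMY** (RH-FREE as a dichotomy; Yoshida's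
threshold in screw coordinates): EITHER every ratio `R` is good (every window `(N, M]`, `M ≤ R(N+1)`,
is non-negative on balanced vectors), OR there is a threshold ratio `R₀ ≥ 7` such that (i) every ratio
`R ≤ R₀` is good and (ii) every ratio `R > R₀` fails on EVERY sufficiently high window: `∃ N₁, ∀ N ≥ N₁,
∃ M ≤ R(N+1)` and a balanced real `x` on `(N, M]` with `∑ G(log m, log m') x_m x_{m'} < 0`
(`R₀ = ⌊e^{2a₀}⌋`, `a₀` Yoshida's threshold; `R₀ ≥ 7` by the rung `a = 1`). [cite: Yoshida1992, Prop. 6] -/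
theorem screwWindow_ratio_threshold :
    (∀ R N M : ℕ, M ≤ R * (N + 1) → ∀ x : ℕ → ℝ, ∑ m ∈ Ioc N M, x m = 0 →
      0 ≤ ∑ m ∈ Ioc N M, ∑ m' ∈ Ioc N M,
        zetaScrewKernel (Real.log m) (Real.log m') * (x m * x m')) ∨
    ∃ R₀ : ℕ, 7 ≤ R₀ ∧
      (∀ R : ℕ, R ≤ R₀ → ∀ N M : ℕ, M ≤ R * (N + 1) → ∀ x : ℕ → ℝ, ∑ m ∈ Ioc N M, x m = 0 →
        0 ≤ ∑ m ∈ Ioc N M, ∑ m' ∈ Ioc N M,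
          zetaScrewKernel (Real.log m) (Real.log m') * (x m * x m')) ∧
      (∀ R : ℕ, R₀ < R → ∃ N₁ : ℕ, ∀ N : ℕ, N₁ ≤ N → ∃ M : ℕ, M ≤ R * (N + 1) ∧
        ∃ x : ℕ → ℝ, ∑ m ∈ Ioc N M, x m = 0 ∧
          ∑ m ∈ Ioc N M, ∑ m' ∈ Ioc N M,
            zetaScrewKernel (Real.log m) (Real.log m') * (x m * x m') < 0) := by
  by_cases hRH : _root_.RiemannHypothesis
  · left
    intro R N M hNM x hx
    exact (riemannHypothesis_iff_forall_balanced_screwWindow.1 hRH) N M x hx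
  right
  obtain ⟨-, hgood, hbad⟩ := Yoshida1992_prop6 hRH
  set a₀ : ℝ := weilPositivityThreshold with ha₀
  -- the certified rung `a = 1` lies below the threshold
  have h1 : (1 : ℝ) ≤ a₀ := by
    by_contra hc
    exact hbad 1 (not_le.1 hc) WeilFormatCData.A1.weilPositivityOn_one
  set R₀ : ℕ := ⌊Real.exp (2 * a₀)⌋₊ with hR₀
  have hexp : (7 : ℝ) < Real.exp (2 * a₀) := by
    have h := Real.exp_one_gt_d9
    have h2 : Real.exp 2 = Real.exp 1 * Real.exp 1 := by rw [← Real.exp_add]; norm_num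
    have h3 : Real.exp 2 ≤ Real.exp (2 * a₀) := Real.exp_le_exp.2 (by linarith)
    nlinarith
  refine ⟨R₀, ?_, ?_, ?_⟩
  · -- `7 ≤ ⌊e^{2a₀}⌋`
    exact Nat.le_floor (by exact_mod_cast hexp.le)
  · -- ratios `R ≤ R₀` are good: `log R ≤ 2a₀`
    intro R hR N M hNM x hx
    refine screwWindow_nonneg_of_weilPositivityOn_ratio (hgood _ ?_) N M hNM x hx
    rcases Nat.eq_zero_or_pos R with h0 | h0
    · rw [h0]; simp only [Nat.cast_zero, Real.log_zero, zero_div]; linarith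
    have hRpos : (0 : ℝ) < R := by exact_mod_cast h0
    have hRle : (R : ℝ) ≤ Real.exp (2 * a₀) :=
      (show (R : ℝ) ≤ (R₀ : ℝ) by exact_mod_cast hR).trans (Nat.floor_le (Real.exp_pos _).le)
    have hlog : Real.log R ≤ 2 * a₀ := by
      rw [Real.log_le_iff_le_exp hRpos]; exact hRle
    linarith
  · -- ratios `R > R₀` fail on every high window: `log R > 2a₀`
    intro R hR
    have hRgt : Real.exp (2 * a₀) < R := by
      have h := Nat.lt_floor_add_one (Real.exp (2 * a₀))
      have h' : ((R₀ + 1 : ℕ) : ℝ) ≤ R := by exact_mod_cast hR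
      push_cast at h'
      linarith
    have hRpos : (0 : ℝ) < R := (Real.exp_pos _).trans hRgt
    have hlog : 2 * a₀ < Real.log R := by
      rw [Real.lt_log_iff_exp_lt hRpos]; exact hRgt
    have hfail : ¬ WeilPositivityOn (Real.log R / 2) := hbad _ (by linarith)
    obtain ⟨N₁, hN₁⟩ := eventually_exists_negative_ratio_window_of_not_weilPositivityOn hfail
    refine ⟨N₁, fun N hN => ?_⟩
    obtain ⟨M, hM, x, hx, hneg⟩ := hN₁ N hN
    refine ⟨M, ?_, x, hx, hneg⟩
    -- `⌈e^{log R}⌉ = R`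
    have e : ⌈Real.exp (2 * (Real.log R / 2))⌉₊ = R := by
      rw [show 2 * (Real.log R / 2) = Real.log R by ring, Real.exp_log hRpos, Nat.ceil_natCast]
    rw [e] at hM
    exact hM

/-- **¬RH ⟺ a threshold ratio exists** (RH-EQUIVALENT content, labelled): RH fails iff there is
`R₀ ≥ 7` such that exactly the ratios `R ≤ R₀` are good and every larger ratio fails on every
sufficiently high window. [cite: Yoshida1992, Prop. 6] -/
theorem not_riemannHypothesis_iff_exists_ratio_threshold :
    ¬ _root_.RiemannHypothesis ↔ ∃ R₀ : ℕ, 7 ≤ R₀ ∧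
      (∀ R : ℕ, R ≤ R₀ → ∀ N M : ℕ, M ≤ R * (N + 1) → ∀ x : ℕ → ℝ, ∑ m ∈ Ioc N M, x m = 0 →
        0 ≤ ∑ m ∈ Ioc N M, ∑ m' ∈ Ioc N M,
          zetaScrewKernel (Real.log m) (Real.log m') * (x m * x m')) ∧
      (∀ R : ℕ, R₀ < R → ∃ N₁ : ℕ, ∀ N : ℕ, N₁ ≤ N → ∃ M : ℕ, M ≤ R * (N + 1) ∧
        ∃ x : ℕ → ℝ, ∑ m ∈ Ioc N M, x m = 0 ∧
          ∑ m ∈ Ioc N M, ∑ m' ∈ Ioc N M,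
            zetaScrewKernel (Real.log m) (Real.log m') * (x m * x m') < 0) := by
  constructor
  · intro hRH
    rcases screwWindow_ratio_threshold with hall | hthr
    · exact absurd (riemannHypothesis_iff_forall_balanced_screwWindow.2
        fun N M x hx => hall (M + 1) N M
          ((Nat.le_succ M).trans (Nat.le_mul_of_pos_right _ (Nat.succ_pos N))) x hx) hRH
    · exact hthr
  · rintro ⟨R₀, -, -, hbad⟩ hRH
    obtain ⟨N₁, hN₁⟩ := hbad (R₀ + 1) (Nat.lt_succ_self R₀)
    obtain ⟨M, -, x, hx, hneg⟩ := hN₁ N₁ le_rfl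
    have := (riemannHypothesis_iff_forall_balanced_screwWindow.1 hRH) N₁ M x hx
    linarith

end Summit.RiemannHypothesis.RiemannHypothesis.Theorems.IntegerScrew

end
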